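import Summits.NavierStokesRegularity.NavierStokesRegularity.Theorems.ExtremiserTransienceNearExtremalTransiencePerFlowPorosityCalculus
import Summits.NavierStokesRegularity.NavierStokesRegularity.Theorems.ExtremiserTransienceNearExtremalTransiencePerFlowStubEfficiencyContinuous
import Summits.NavierStokesRegularity.NavierStokesRegularity.Theorems.ExtremiserTransienceNearExtremalTransienceDSSPerFlowAnalytic
import Summits.NavierStokesRegularity.NavierStokesRegularity.Theorems.ExtremiserTransienceKStarAttainedHalfSpaceVariation
import Summits.NavierStokesRegularity.NavierStokesRegularity.Theses.ExtremiserTransience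
import HarnessLib

/-!
# Crux `NearExtremalTransiencePerFlow` (stmt-NavierStokesRegularity-26567) — LINE g7-β «zone transversality», POROUS FORM
# (prover ns-net-p1, repair sketch accompanying `ZoneTransversalityZ2Verdict.md`): Z1* → Z3 (landed) → Z4* (landed) → crux BY NAME

The filed skeleton `Lines/zone_transversality.lean` composes Z1 (sojourn bound) → Z2 (zone log-Lipschitz) → Z3 (continuity) → Z4
(zone calculus).  Z3 and Z4 are LANDED (p661994, p660552); Z2 is crux-sized (it contains the pointwise upper scale lock on the
near-extremal set, see the verdict note).  The composition consumes Z1+Z2 only through UNIFORM LOG-POROSITY of the near-extremal time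
set, so this sketch replaces them by the single dynamical statement Z1* `stub_porousZone` (implied by Z1 ∧ Z2 ∧ Z3) and uses the landed
porosity calculus `logMean_le_of_porousZone` (p662762) in place of Z4.  The ONLY `sorry` is Z1*.  Vocabulary `IsViolator`,
`IsMinimalCoeff`, `PFC` = `Theorems/ExtremiserTransienceZoneTransversalityDefs.lean` (verbatim §0 of the filed skeleton).
HONEST FRAMING: an implication between an OPEN statement about hypothetical Type-I singular flows and the crux; nothing about
Navier–Stokes regularity or blow-up is proved; no summit is proved by a line.
-/

noncomputable section

open scoped Topology InnerProductSpace RealInnerProductSpace ENNReal ContDiff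
open MeasureTheory Filter Set Metric
open Literature.Analysis.FluidPDE
open Summit.NavierStokesRegularity.NavierStokesRegularity.Theses.ExtremiserTransience
open Summit.NavierStokesRegularity.NavierStokesRegularity.Theorems
open Summit.NavierStokesRegularity.NavierStokesRegularity.Theorems.DepletionLadder.KStar.HalfSpace
open Summit.NavierStokesRegularity.NavierStokesRegularity.Theorems.NearExtremalTransiencePerFlow.ZoneTransversality

namespace Summit.NavierStokesRegularity.NavierStokesRegularity.Cruxes.NearExtremalTransiencePerFlow.ZoneTransversalityPorous

set_option linter.dupNamespace false
set_option linter.unusedVariables false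

/-! ## §1 The one open statement -/

/-- (Z1*, OPEN HEART) UNIFORM LOG-POROSITY OF THE NEAR-EXTREMAL TIME SET «no lingering near the top, even intermittently»: for a
violator flow and its minimal coefficient there are `ε, ρ, W > 0` (`ρ ≤ W`) and an onset `t₁` such that every late time `s` is followed,
within log-time `W`, by a closed interval of log-length `≥ ρ` spent `ε`-below the top: `k₀ ≤ κ⋆ − ε` on `[a,b]`. -/
def PorousZone : Prop :=
  ∀ (C ν T : ℝ) (u : ℝ → EuclideanSpace ℝ (Fin 3) → EuclideanSpace ℝ (Fin 3)) (p : ℝ → EuclideanSpace ℝ (Fin 3) → ℝ),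
    IsViolator C ν T u p → ∀ k₀ : ℝ → ℝ, IsMinimalCoeff T u k₀ →
      ∃ ε ρ W : ℝ, 0 < ε ∧ 0 < ρ ∧ ρ ≤ W ∧ ∃ t₁ ∈ Set.Ico 0 T, ∀ s ∈ Set.Ico t₁ T,
        ∃ a b : ℝ, s ≤ a ∧ a ≤ b ∧ b < T ∧ Real.log ((T - s) / (T - b)) ≤ W ∧
          ρ ≤ Real.log ((T - a) / (T - b)) ∧ ∀ τ ∈ Set.Icc a b, k₀ τ ≤ kStar - ε

/-! ## §2 Registered stub (the only `sorry`) -/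

/-- Z1* (OPEN HEART). -/
theorem stub_porousZone :
    ∀ (C ν T : ℝ) (u : ℝ → EuclideanSpace ℝ (Fin 3) → EuclideanSpace ℝ (Fin 3)) (p : ℝ → EuclideanSpace ℝ (Fin 3) → ℝ),
    IsViolator C ν T u p → ∀ k₀ : ℝ → ℝ, IsMinimalCoeff T u k₀ →
      ∃ ε ρ W : ℝ, 0 < ε ∧ 0 < ρ ∧ ρ ≤ W ∧ ∃ t₁ ∈ Set.Ico 0 T, ∀ s ∈ Set.Ico t₁ T,
        ∃ a b : ℝ, s ≤ a ∧ a ≤ b ∧ b < T ∧ Real.log ((T - s) / (T - b)) ≤ W ∧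
          ρ ≤ Real.log ((T - a) / (T - b)) ∧ ∀ τ ∈ Set.Icc a b, k₀ τ ≤ kStar - ε := by
  sorry

namespace Registered
/-- Registered name of Z1*. -/
abbrev stub_porousZone : Prop := PorousZone
end Registered

theorem stub_porousZone_holds : Registered.stub_porousZone := stub_porousZone

/-! ## §3 Composition (kernel-checked): Z1* → [Z3, Z4* landed] → the crux BY NAME -/

theorem NearExtremalTransiencePerFlow_of (h1 : Registered.stub_porousZone) : NearExtremalTransiencePerFlow := by
  have h1' : PorousZone := h1
  intro C ν T hC hν hT u p hsol hLH hdec hrate hne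
  by_contra hno
  have hV : IsViolator C ν T u p := ⟨hC, hν, hT, hsol, hLH, hdec, hrate, hne, hno⟩
  obtain ⟨k₀, hk₀m, hk₀01, hcl, hmin⟩ := DepletionLadder.exists_canonical_coefficient hν hT hsol hLH hdec
  have hK : IsMinimalCoeff T u k₀ := ⟨hk₀m, hk₀01, hcl, hmin⟩
  obtain ⟨ε, ρ, W, hε, hρ, hρW, t₁, ht₁, hpor⟩ := h1' C ν T u p hV k₀ hK
  have hcont : ContinuousOn k₀ (Set.Ioo 0 T) := stub_efficiencyContinuous C ν T u p hV k₀ hK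
  have hlt := DepletionLadder.minimalCoeff_lt_sharp_of_pos hν hT hsol hLH hdec hmin
  -- onset `t₃ = max t₁ (T/2)`
  set t₃ : ℝ := max t₁ (T / 2) with ht₃def
  have ht₃T : t₃ < T := max_lt ht₁.2 (by linarith)
  have ht₃0 : 0 < t₃ := lt_of_lt_of_le (by linarith) (le_max_right _ _)
  have ht₁3 : t₁ ≤ t₃ := le_max_left _ _
  have hks : ∀ τ ∈ Set.Ico t₃ T, k₀ τ ≤ kStar := by
    intro τ hτ
    have h := (hlt τ ⟨ht₃0.trans_le hτ.1, hτ.2⟩).le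
    unfold kStar udcSet
    exact h
  have hcont₃ : ContinuousOn k₀ (Set.Ico t₃ T) := hcont.mono fun τ hτ => ⟨ht₃0.trans_le hτ.1, hτ.2⟩
  have hpor₃ : ∀ s ∈ Set.Ico t₃ T, ∃ a b : ℝ, s ≤ a ∧ a ≤ b ∧ b < T ∧ Real.log ((T - s) / (T - b)) ≤ W ∧
      ρ ≤ Real.log ((T - a) / (T - b)) ∧ ∀ τ ∈ Set.Icc a b, k₀ τ ≤ kStar - ε :=
    fun s hs => hpor s ⟨ht₁3.trans hs.1, hs.2⟩
  obtain ⟨θ₀, B, hθ₀0, hθ₀1, hmean⟩ :=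
    logMean_le_of_porousZone k₀ T t₃ kStar ε ρ W kStar_pos hε hρ hρW ht₃T (fun τ => (hk₀01 τ).1) hks hcont₃ hpor₃
  apply hno
  refine ⟨θ₀, hθ₀0, hθ₀1, fun κ hκ => ?_⟩
  have hκs : kStar ≤ κ := by
    unfold kStar udcSet
    exact DepletionLadder.sharpDepletion_le hκ
  refine ⟨t₃, ⟨ht₃0.le, ht₃T⟩, k₀, B, hk₀m, hk₀01,
    fun t ht M hM => hcl t ⟨ht₃0.le.trans ht.1, ht.2⟩ M hM, fun t ht => ?_⟩
  have hlog : 0 ≤ Real.log ((T - t₃) / (T - t)) :=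
    Real.log_nonneg ((one_le_div (sub_pos.2 ht.2)).2 (by linarith [ht.1]))
  have h0 : 0 ≤ θ₀ * kStar := mul_nonneg hθ₀0 kStar_pos.le
  have hmono : (θ₀ * kStar) ^ 2 ≤ (θ₀ * κ) ^ 2 :=
    pow_le_pow_left₀ h0 (mul_le_mul_of_nonneg_left hκs hθ₀0) 2
  calc ∫ τ in t₃..t, k₀ τ ^ 2 / (T - τ) ≤ (θ₀ * kStar) ^ 2 * Real.log ((T - t₃) / (T - t)) + B := hmean t ht
    _ ≤ (θ₀ * κ) ^ 2 * Real.log ((T - t₃) / (T - t)) + B := by nlinarith [hmono, hlog]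

end Summit.NavierStokesRegularity.NavierStokesRegularity.Cruxes.NearExtremalTransiencePerFlow.ZoneTransversalityPorous

end
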